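import Literature.MathematicalPhysics.QuantumFieldTheory.Balaban1983to89.B8CubeMemberBoxDomains
import Literature.MathematicalPhysics.QuantumFieldTheory.Balaban1983to89.B6MultiLevelBoxOperatorL0

/-!
# `Balaban1983to89.B8CubeMemberBoxDomainsL0` — [Balaban1985RegularSpaces] p. 98–99: THE WHOLE CUBE MEMBER `□₀ ⊃ □₁ ⊃ … ⊃ □_n`, LEVEL `0`
# INCLUDED, IS A MEMBER OF THE [B6] §2 NEUMANN-BOX FAMILY WITH `Λ₀` (`B6MultiLevelBoxOperatorL0.Domains`)

statement-level skeleton of published theorems with citation tags; proofs where landed; nothing here is a claim about the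
Yang–Mills mass gap

`[Balaban1985RegularSpaces]` ("B8", CMP **99** (1985) 75–102) p. 98 («Let us take a sequence of cubes □₀, □₁, …, □_{k−1}, □_k, □, such that □_j ⊃ □_{j+1}
and a distance between boundaries of these cubes is equal to R₁M₁Lʲη … for every j the cube □_j is a sum of the big blocks of the lattice T_{L^{−j}}»),
(1.131) p. 99 («Λ′₀ = T ∖ □₁»), (1.91)–(1.92) p. 91; `[Balaban1984PropagatorsII]` ("B6", CMP **96** (1984) 223–250) (2.1)–(2.4) p. 224 («Λ₀ = Ω₁ᶜ …
B⁰(Λ₀) = Λ₀»), (2.14) p. 225 («(Q′₀λ)(x) = λ(x), x ∈ Λ₀»), p. 229 (the boundary-condition paragraph).  PDF held: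
`paper:balaban1985-cmp99-regular-spaces-gauge-fixing` (journal page = PDF page + 74).

CITATION HEADER (lean-in-tree rule).  Cell `pub-ymgap` (YM Track A, HUMAN RULING D-0062), DAG node N05 = [B8], seat `pub-ymgap-dag-n05-c` (g10; the (R1′)
programme of this base: the three REAL inequality families of n05-e's `B8Prop6CubeMemberFlatScalar.prop6_cubeMember_flat_of_real` reduced by F1–F14 of this
base to ONE named estimate `B8Thm32GBoundCubeMember.GBoundCubeMemberPrinted` = [4] Thm 3.2 at `U = 1` on the cube member).  THE LOCATED FACT THIS FILE
ACTS ON: the [B6] §2 chain WITH THE LEVEL `0` ADMITTED landed in the tree on 2026-08-27 (lit-balaban r03∕p21∕r05, programme G-F3′-L0: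
`B6MultiLevelBoxOperatorL0`, …, `B6Prop23MultiLevelBoxL0.prop23_multiLevelBox` — [B6] Prop. 2.3 (2.87) HYPOTHESIS-FREE on the Neumann box `X` with
`Λ₀ = X ∖ Ω₁ ≠ ∅`, finite level-`0` weight `a₀`).  F1 of this base (`B8CubeMemberBoxDomains.cubeDomains`) made the INNER cubes `□₁ ⊃ … ⊃ □_n` a member of the
level-`≥ 1` family; THIS FILE makes the WHOLE member — the level-`0` collar `□₀ ∖ □₁` and everything of the host box outside `t + □₁` at level `0` — a
member of the level-`0` structure, with the same translation `t` and the same host box `X` as F1, so that p21's `(Q′G′²Q′*)⁻¹` of the box can be read at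
the cube member's towers of EVERY level (successor files `B8CubeMemberBoxRowsL0`, `B8Thm32GBoundCubeMemberHolds`).

WHAT THIS FILE PROVES (kernel-checked; `L = ℓ + 1`; cube datum `(a, M, ρ, k)` of `B8Eq131Cubes`, truncation `1 ≤ n ≤ k`; side conditions as F1:
`M_h·L ∣ ρ`, `M_h·L ∣ M`, `R·(M_h·L) ≤ ρ`).
* §1 `levL0` — the level function of the whole member: F1's `lev` on `t + □₁`, `0` elsewhere («Λ₀ = Ω₁ᶜ»); `levL0_of_mem`, `levL0_of_not_mem`, `levL0_le`,
  ★ `le_levL0_iff` (`j ≤ levL0 y ⇔ y − t ∈ □_j` for `1 ≤ j ≤ n` — now without F1's side hypothesis at `j = 1`), `levL0_pos_iff`.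
* §2 ★★ `cubeDomainsL0 : B6MultiLevelBoxOperatorL0.Domains d ℓ M_h n (boxP …) R` — THE MEMBER WITH `Λ₀`: `lev = levL0`, `lev ≤ n`, (2.1) `bigBlocks` for EVERY `j ≥ 1`
  (F1 `mem_cube_iff_of_blk_eq`), (2.2) `sep` (F1 `collar_gap`, vacuous below level `0`); `cubeDomainsL0_lev` (`rfl`).
* §3 dictionary with the cube member's towers at EVERY level: ★ `tower_iff_levL0_eq` — for `x ∈ □₀` and `j ≤ n`, `blockMap (Lʲ) x ∈ cubeLamS … n j ⇔
  levL0 (x + t) = j` (level `0`: `x ∈ □₀ ∖ □₁`, `B8CubeMemberZd.mem_cubeLam_zero_iff`); `blockMap_pow_zero`; ★ `mem_boxDom_of_mem_cube_zero` (`t + □₀ ⊂ X`, `M_h ≥ 2`).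

HONEST SCOPE ∕ NOT CLAIMED.  Geometry and bookkeeping; no estimate is proved here and p21's theorems are not yet applied (successor files).  The host box
carries Neumann conditions and the finite mass `a₀` on ALL its level-`0` sites, the consumer's matrix is the DIRICHLET matrix of `□₀`: the two operators agree
row by row only at sites whose lattice neighbours lie in `□₀` (successor `B8CubeMemberBoxRowsL0`); the 𝒢-bound transfer (successor `B8Thm32GBoundCubeMemberHolds`)
uses exactly those rows.  Count-neutral; N05 NOT discharged; one finite `T⁴` programme at fixed `ε`, Bałaban as printed; nothing continuum ∕ ℝ⁴ ∕ OS ∕ mass-gap ∕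
Clay.  No `sorry`, no `instance`, no `notation`; one `def` (`levL0`) and one structure-valued `def` (`cubeDomainsL0`).  Unit `pub-ymgap-dag-n05-c` (g10), 2026-08-27.

RELATED IN THE TREE, NOT DUPLICATED (`rg` 2026-08-27T19:40Z: the only terms of `B6MultiLevelBoxOperatorL0.Domains` are its own `ofBox`, `top`, `floor`, `split01`):
`B8CubeMemberBoxDomains.{shift, boxP, lev, le_lev_iff, mem_cube_iff_of_blk_eq, collar_gap, mem_boxDom_of_mem_cube, tower_iff_lev_eq, cubeDomains}` (F1, USED —
`Domains.ofBox (cubeDomains …)` has NO level `0` and is not the member built here), `B6MultiLevelBoxOperatorL0.Domains` (r03, USED), `B8CubeMemberZd.mem_cubeLam_zero_iff`,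
`B8Eq191FlatLettersCubeMember.cubeFam_antitone`, `B8Eq191FlatDirichletDepth.mem_cube_of_le_tower` (USED).
-/
noncomputable section

namespace Literature.MathematicalPhysics.QuantumFieldTheory.Balaban1983to89.B8CubeMemberBoxDomainsL0

open B6MultiLevelBoxOperator (N0 bigSide)
open B4Reflection242 (boxDom mem_boxDom blk)
open B4ContourShift (supNorm abs_le_supNorm)
open B7Prop1Local (InBox)
open B8Eq131Cubes (gs cube bLo bHi)
open B8Eq131CubesAdmissible (cubeFam cubeFam_false_of_le)
open B8CubeMemberZd (cubeLamS)
open B8Eq191FlatDirichletDepth (fm loC hiC mem_cube_iff_inBox fm_succ fm_add_le mem_cube_of_le_tower)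
open B8Eq191FlatLettersCubeMember (cubeFam_antitone)
open B8CubeMemberBoxDomains (shift boxP lev one_le_lev lev_le le_lev_iff mem_cube_iff_of_blk_eq collar_gap fm_one_le fm_one_le_top fm_le_fm_one
  N0_boxP_eq R_bigSide_le add_shift_sub_shift tower_iff_lev_eq)
open Literature.MathematicalPhysics.QuantumLattice (blockMap)

variable {d : ℕ}

/-! ## §1 The level function of the whole member (level `0` off `t + □₁`) -/

open Classical in
/-- The level function of the translated cube member with its collar: F1's `lev` (the deepest `j ≤ n` with `y − t ∈ □_j`) on `t + □₁`, and `0` off `t + □₁`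
— print's «Λ₀ = Ω₁ᶜ», «B⁰(Λ₀) = Λ₀» for `Ω₁ = t + □₁` inside the host box. [cite: Balaban1984PropagatorsII, (2.3)–(2.4) p.224; Balaban1985RegularSpaces, (1.131) p.99 («Λ′₀ = T ∖ □₁»)] -/
def levL0 (ℓ Mh : ℕ) (a : Fin (d + 1) → ℤ) (M ρ k n : ℕ) (y : Fin (d + 1) → ℤ) : ℕ :=
  if y - shift ℓ Mh a ρ k n ∈ cube (ℓ + 1) a M ρ k 1 then lev ℓ Mh a M ρ k n y else 0

/-- On `t + □₁` the level is F1's `lev`. [cite: Balaban1984PropagatorsII, (2.3)–(2.4) p.224] -/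
theorem levL0_of_mem {ℓ Mh : ℕ} {a : Fin (d + 1) → ℤ} {M ρ k n : ℕ} {y : Fin (d + 1) → ℤ} (h : y - shift ℓ Mh a ρ k n ∈ cube (ℓ + 1) a M ρ k 1) :
    levL0 ℓ Mh a M ρ k n y = lev ℓ Mh a M ρ k n y := by
  classical
  unfold levL0; rw [if_pos h]

/-- Off `t + □₁` the level is `0`. [cite: Balaban1984PropagatorsII, (2.3)–(2.4) p.224 («Λ₀ = Ω₁ᶜ»)] -/
theorem levL0_of_not_mem {ℓ Mh : ℕ} {a : Fin (d + 1) → ℤ} {M ρ k n : ℕ} {y : Fin (d + 1) → ℤ} (h : y - shift ℓ Mh a ρ k n ∉ cube (ℓ + 1) a M ρ k 1) :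
    levL0 ℓ Mh a M ρ k n y = 0 := by
  classical
  unfold levL0; rw [if_neg h]

/-- `levL0 ≤ n` (`1 ≤ n`). [cite: Balaban1984PropagatorsII, (2.3)–(2.4) p.224] -/
theorem levL0_le (ℓ Mh : ℕ) (a : Fin (d + 1) → ℤ) (M ρ k : ℕ) {n : ℕ} (hn : 1 ≤ n) (y : Fin (d + 1) → ℤ) : levL0 ℓ Mh a M ρ k n y ≤ n := by
  by_cases h : y - shift ℓ Mh a ρ k n ∈ cube (ℓ + 1) a M ρ k 1
  · rw [levL0_of_mem h]; exact lev_le ℓ Mh a M ρ k hn y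
  · rw [levL0_of_not_mem h]; exact Nat.zero_le _

/-- `□_j ⊆ □₁` for `1 ≤ j ≤ k`. [cite: Balaban1985RegularSpaces, p.98 («□_j ⊃ □_{j+1}»)] -/
theorem cube_subset_cube_one {ℓ : ℕ} (a : Fin (d + 1) → ℤ) (M : ℕ) {ρ k j : ℕ} (hρ : ℓ + 1 ≤ ρ) (hj : 1 ≤ j) (hjk : j ≤ k) :
    cube (ℓ + 1) a M ρ k j ⊆ cube (ℓ + 1) a M ρ k 1 := by
  have hL : 1 ≤ ℓ + 1 := Nat.succ_pos ℓ
  have h := cubeFam_antitone hL a M hρ k hj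
  rw [cubeFam_false_of_le _ a M ρ hjk, cubeFam_false_of_le _ a M ρ (hj.trans hjk)] at h
  exact h

/-- `□₁ ⊆ □₀` (`1 ≤ k`). [cite: Balaban1985RegularSpaces, p.98 («□_j ⊃ □_{j+1}»)] -/
theorem cube_one_subset_cube_zero {ℓ : ℕ} (a : Fin (d + 1) → ℤ) (M : ℕ) {ρ k : ℕ} (hρ : ℓ + 1 ≤ ρ) (hk : 1 ≤ k) :
    cube (ℓ + 1) a M ρ k 1 ⊆ cube (ℓ + 1) a M ρ k 0 := by
  have hL : 1 ≤ ℓ + 1 := Nat.succ_pos ℓ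
  have h := cubeFam_antitone hL a M hρ k (Nat.zero_le 1)
  rw [cubeFam_false_of_le _ a M ρ hk, cubeFam_false_of_le _ a M ρ (Nat.zero_le k)] at h
  exact h

/-- **`Ω_j = {j ≤ levL0}` IS THE TRANSLATED `□_j`** for `1 ≤ j ≤ n` — with no side hypothesis (off `t + □₁` both sides fail).
[cite: Balaban1984PropagatorsII, (2.3)–(2.4) p.224; Balaban1985RegularSpaces, (1.3) p.77, (1.131) p.99] -/
theorem le_levL0_iff {ℓ Mh : ℕ} (a : Fin (d + 1) → ℤ) (M : ℕ) {ρ k n j : ℕ} (hρ : ℓ + 1 ≤ ρ) (hnk : n ≤ k) (hj : 1 ≤ j) (hjn : j ≤ n)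
    (y : Fin (d + 1) → ℤ) :
    j ≤ levL0 ℓ Mh a M ρ k n y ↔ y - shift ℓ Mh a ρ k n ∈ cube (ℓ + 1) a M ρ k j := by
  by_cases h : y - shift ℓ Mh a ρ k n ∈ cube (ℓ + 1) a M ρ k 1
  · rw [levL0_of_mem h]
    exact le_lev_iff a M hρ hnk hj hjn y (fun _ => h)
  · rw [levL0_of_not_mem h]
    constructor
    · intro h0; omega
    · intro hy; exact absurd (cube_subset_cube_one a M hρ hj (hjn.trans hnk) hy) h

/-- `0 < levL0 y ⇔ y − t ∈ □₁` (`1 ≤ n ≤ k`). [cite: Balaban1984PropagatorsII, (2.3)–(2.4) p.224 («Λ₀ = Ω₁ᶜ»)] -/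
theorem levL0_pos_iff {ℓ Mh : ℕ} (a : Fin (d + 1) → ℤ) (M : ℕ) {ρ k n : ℕ} (hρ : ℓ + 1 ≤ ρ) (hn : 1 ≤ n) (hnk : n ≤ k) (y : Fin (d + 1) → ℤ) :
    0 < levL0 ℓ Mh a M ρ k n y ↔ y - shift ℓ Mh a ρ k n ∈ cube (ℓ + 1) a M ρ k 1 :=
  le_levL0_iff a M hρ hnk le_rfl hn y

/-! ## §2 The member of the [B6] §2 family WITH `Λ₀` -/

/-- **THE WHOLE CUBE MEMBER (TRANSLATED BY `t`) IS A MEMBER OF THE [B6] §2 NEUMANN-BOX FAMILY WITH `Λ₀`** (`B6MultiLevelBoxOperatorL0.Domains d ℓ M_h n P R`):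
levels `0 … n` — `Ω_j = t + □_j` for `1 ≤ j ≤ n`, `Λ₀ = X ∖ (t + □₁)` (the collar `t + (□₀ ∖ □₁)` together with the rest of the host box) — with (2.1) «Ω_j is a sum of
big blocks» for every `j ≥ 1` (collar `ρ = R₁M₁` and core side `M` multiples of the big-block size `M_hL`) and (2.2) `dist(Ω_jᶜ, Ω_{j+1}) > R·M_hL^{j+1}` (from
`R·M_hL ≤ ρ`).  Print ([B6] p. 229): «taking a sequence (2.1) with Ω = Ω_k and smallest possible domains B^j(Λ_j)»; ([B8] p. 98) «for every j the cube □_j is a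
sum of the big blocks of the lattice T_{L^{−j}} … a distance between boundaries of these cubes is equal to R₁M₁Lʲη».
[cite: Balaban1984PropagatorsII, (2.1)–(2.4) p.224, p.229; Balaban1985RegularSpaces, p.98, (1.131) p.99] -/
def cubeDomainsL0 {ℓ Mh : ℕ} (hMh : 1 ≤ Mh) (a : Fin (d + 1) → ℤ) {M ρ k n R : ℕ} (hn : 1 ≤ n) (hnk : n ≤ k)
    (hρ : Mh * (ℓ + 1) ∣ ρ) (hM : Mh * (ℓ + 1) ∣ M) (hρ0 : 0 < ρ) (hR : R * (Mh * (ℓ + 1)) ≤ ρ) :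
    B6MultiLevelBoxOperatorL0.Domains d ℓ Mh n (boxP ℓ M ρ k n) R where
  lev := levL0 ℓ Mh a M ρ k n
  lev_le := levL0_le ℓ Mh a M ρ k hn
  bigBlocks := by
    have hρL : ℓ + 1 ≤ ρ := le_trans (Nat.le_mul_of_pos_left _ hMh) (Nat.le_of_dvd hρ0 hρ)
    intro j hj y _ y' _ hyy
    by_cases hjn : j ≤ n
    · rw [le_levL0_iff a M hρL hnk hj hjn y, le_levL0_iff a M hρL hnk hj hjn y']
      exact mem_cube_iff_of_blk_eq hMh a hρ hM hjn hnk hyy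
    · have h1 := levL0_le ℓ Mh a M ρ k hn y
      have h2 := levL0_le ℓ Mh a M ρ k hn y'
      constructor <;> intro h <;> omega
  sep := by
    have hρL : ℓ + 1 ≤ ρ := le_trans (Nat.le_mul_of_pos_left _ hMh) (Nat.le_of_dvd hρ0 hρ)
    intro j y _ y' _ hlt hle
    have h2 := levL0_le ℓ Mh a M ρ k hn y'
    have hjn : j + 1 ≤ n := le_trans hle h2
    have hj1 : 1 ≤ j := by
      rcases Nat.eq_zero_or_pos j with h0 | hpos
      · subst h0; exact absurd hlt (Nat.not_lt_zero _)
      · exact hpos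
    have hy' : y' - shift ℓ Mh a ρ k n ∈ cube (ℓ + 1) a M ρ k (j + 1) :=
      (le_levL0_iff a M hρL hnk (Nat.succ_pos j) hjn y').mp hle
    have hy : y - shift ℓ Mh a ρ k n ∉ cube (ℓ + 1) a M ρ k j :=
      fun h => absurd ((le_levL0_iff a M hρL hnk hj1 (by omega) y).mpr h) (not_le.mpr hlt)
    obtain ⟨i, hi⟩ := collar_gap a (lt_of_lt_of_le (Nat.lt_of_succ_le hjn) hnk) hy hy'
    have hsub : (y - shift ℓ Mh a ρ k n) i - (y' - shift ℓ Mh a ρ k n) i = (y - y') i := by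
      simp only [Pi.sub_apply]; ring
    rw [hsub] at hi
    have hRle : ((R * bigSide ℓ Mh j : ℕ) : ℝ) ≤ ((ρ * (ℓ + 1) ^ j : ℕ) : ℝ) := by exact_mod_cast R_bigSide_le hR j
    have hi' : ((ρ * (ℓ + 1) ^ j : ℕ) : ℝ) < ((|(y - y') i| : ℤ) : ℝ) := by
      have : ((ρ : ℤ) * ((ℓ + 1 : ℕ) : ℤ) ^ j) < |(y - y') i| := by exact_mod_cast hi
      exact_mod_cast this
    exact lt_of_le_of_lt hRle (lt_of_lt_of_le hi' (abs_le_supNorm (y - y') i))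

/-- The level function of the member is `levL0`. [cite: Balaban1984PropagatorsII, (2.3)–(2.4) p.224] -/
theorem cubeDomainsL0_lev {ℓ Mh : ℕ} (hMh : 1 ≤ Mh) (a : Fin (d + 1) → ℤ) {M ρ k n R : ℕ} (hn : 1 ≤ n) (hnk : n ≤ k)
    (hρ : Mh * (ℓ + 1) ∣ ρ) (hM : Mh * (ℓ + 1) ∣ M) (hρ0 : 0 < ρ) (hR : R * (Mh * (ℓ + 1)) ≤ ρ) :
    (cubeDomainsL0 hMh a hn hnk hρ hM hρ0 hR).lev = levL0 ℓ Mh a M ρ k n := rfl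

/-! ## §3 Dictionary with the tower levels of the cube member at EVERY level, and the embedding of `□₀` -/

/-- The level-`0` block map is the identity: `blockMap (L⁰) y = y`. [folklore] [cite: Balaban1984PropagatorsII, (2.4) p.224 («B⁰(Λ₀) = Λ₀»)] -/
theorem blockMap_pow_zero (L : ℕ) (y : Fin (d + 1) → ℤ) : blockMap (L ^ 0) y = y := by
  funext i; simp [blockMap]

/-- **THE LEVEL OF A TRANSLATED SITE OF `□₀` IS ITS TOWER LEVEL, LEVEL `0` INCLUDED**: for `x ∈ □₀` and `j ≤ n`, the `Lʲ`-block of `x` is a restriction block of the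
truncation-`n` tower iff `levL0 (x + t) = j`; at `j = 0` this reads «`x ∈ □₀ ∖ □₁` iff `x + t ∈ Λ₀`».
[cite: Balaban1985RegularSpaces, (1.5)–(1.6) p.77, (1.68) p.88, (1.131) p.99; Balaban1984PropagatorsII, (2.3)–(2.4) p.224] -/
theorem tower_iff_levL0_eq {ℓ Mh : ℕ} (a : Fin (d + 1) → ℤ) (M : ℕ) {ρ k n j : ℕ} (hρ : ℓ + 1 ≤ ρ) (hn : 1 ≤ n) (hnk : n ≤ k) (hjn : j ≤ n)
    {x : Fin (d + 1) → ℤ} (hx0 : x ∈ cube (ℓ + 1) a M ρ k 0) :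
    blockMap ((ℓ + 1) ^ j) x ∈ cubeLamS (ℓ + 1) a M ρ k n j ↔ levL0 ℓ Mh a M ρ k n (x + shift ℓ Mh a ρ k n) = j := by
  have hL : 1 ≤ ℓ + 1 := Nat.succ_pos ℓ
  have hk : 1 ≤ k := hn.trans hnk
  by_cases hx1 : x ∈ cube (ℓ + 1) a M ρ k 1
  · rw [levL0_of_mem (by rw [add_shift_sub_shift]; exact hx1)]
    exact tower_iff_lev_eq a M hρ hn hnk hjn hx1
  · rw [levL0_of_not_mem (by rw [add_shift_sub_shift]; exact hx1)]
    constructor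
    · intro h
      by_contra hj0
      have hj1 : 1 ≤ j := by omega
      exact hx1 (mem_cube_of_le_tower hL a M hρ hnk hjn hj1 h)
    · intro h
      have hj0 : j = 0 := h.symm
      subst hj0
      rw [blockMap_pow_zero, B8CubeMemberZd.cubeLamS_of_lt _ a M ρ k hn, B8CubeMemberZd.mem_cubeLam_zero_iff hL a M ρ hk]
      exact ⟨hx0, hx1⟩

/-- A level-`0` site of the member inside `t + □₀` is a translated site of the collar `□₀ ∖ □₁`. [cite: Balaban1985RegularSpaces, (1.131) p.99; Balaban1984PropagatorsII, (2.3) p.224] -/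
theorem mem_collar_of_levL0_eq_zero {ℓ Mh : ℕ} (a : Fin (d + 1) → ℤ) (M : ℕ) {ρ k n : ℕ} (hρ : ℓ + 1 ≤ ρ) (hn : 1 ≤ n) (hnk : n ≤ k)
    {x : Fin (d + 1) → ℤ} (hx0 : x ∈ cube (ℓ + 1) a M ρ k 0) (h0 : levL0 ℓ Mh a M ρ k n (x + shift ℓ Mh a ρ k n) = 0) :
    x ∈ cubeLamS (ℓ + 1) a M ρ k n 0 := by
  have h := (tower_iff_levL0_eq a M hρ hn hnk (Nat.zero_le n) hx0 (Mh := Mh)).mpr h0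
  rwa [blockMap_pow_zero] at h

/-- The outer margin exceeds the inner ones by less than `ρLⁿ`: `fm 0 ≤ fm n + ρLⁿ` (`1 ≤ n ≤ k`, `L ≥ 2`). [cite: Balaban1985RegularSpaces, p.98 («Σ_{j=0}^{k} R₁M₁Lʲη < (1 − L⁻¹)⁻¹R₁M₁Lᵏη ≤ 2R₁M₁Lᵏη»)] -/
theorem fm_zero_le {L ρ k n : ℕ} (hL : 2 ≤ L) (hn : 1 ≤ n) (hnk : n ≤ k) : fm L ρ k 0 ≤ fm L ρ k n + ρ * L ^ n := by
  have h0 : fm L ρ k 0 = fm L ρ k 1 + ρ * L ^ 0 := fm_succ (lt_of_lt_of_le Nat.zero_lt_one (hn.trans hnk))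
  have h1 := fm_one_le (L := L) (ρ := ρ) (k := k) hL hn hnk
  have hL1 : ρ * 1 ≤ ρ * L := Nat.mul_le_mul_left _ (by omega)
  rw [pow_zero] at h0
  omega

/-- **THE TRANSLATED `□₀` LIES IN THE HOST BOX `X = Π_μ[0, Lⁿ·L·M_h·P_μ)`** (`L ≥ 2`, `M_h ≥ 2`, `1 ≤ n ≤ k`): the level-`0` collar of the cube member is carried by the
same box as F1's inner family. [cite: Balaban1984PropagatorsII, (2.1) p.224 («Ω_j ⊂ T_η»); Balaban1985RegularSpaces, p.98] -/
theorem mem_boxDom_of_mem_cube_zero {ℓ Mh : ℕ} (hℓ : 1 ≤ ℓ) (hMh : 2 ≤ Mh) (a : Fin (d + 1) → ℤ) {M ρ k n : ℕ} (hn : 1 ≤ n) (hnk : n ≤ k)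
    {x : Fin (d + 1) → ℤ} (hx : x ∈ cube (ℓ + 1) a M ρ k 0) :
    x + shift ℓ Mh a ρ k n ∈ boxDom (N0 ℓ Mh n (boxP ℓ M ρ k n)) := by
  have hL2 : 2 ≤ ℓ + 1 := by omega
  have hk : 1 ≤ k := hn.trans hnk
  rw [mem_boxDom]
  intro i
  rw [mem_cube_iff_inBox a M ρ (Nat.zero_le k)] at hx
  obtain ⟨h1, h2⟩ := hx i
  -- the two corner identities
  have e1 : loC (ℓ + 1) a ρ k 0 i + shift ℓ Mh a ρ k n i
      = ((Mh * (ℓ + 1) ^ (n + 1) * ρ : ℕ) : ℤ) + (fm (ℓ + 1) ρ k n : ℤ) - (fm (ℓ + 1) ρ k 0 : ℤ) := by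
    unfold shift loC; simp only [bLo]; push_cast; ring
  have e2 : hiC (ℓ + 1) a M ρ k 0 i + 1 + shift ℓ Mh a ρ k n i
      = (((ℓ + 1) ^ k * M : ℕ) : ℤ) + (fm (ℓ + 1) ρ k 0 : ℤ) + ((Mh * (ℓ + 1) ^ (n + 1) * ρ : ℕ) : ℤ) + (fm (ℓ + 1) ρ k n : ℤ) := by
    unfold shift hiC loC; simp only [bHi, bLo]; push_cast; ring
  -- natural-number bounds on the margins
  have hA : fm (ℓ + 1) ρ k 0 ≤ fm (ℓ + 1) ρ k n + Mh * (ℓ + 1) ^ (n + 1) * ρ := by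
    have h := fm_zero_le (L := ℓ + 1) (ρ := ρ) (k := k) hL2 hn hnk
    have h' : ρ * (ℓ + 1) ^ n ≤ Mh * (ℓ + 1) ^ (n + 1) * ρ := by
      calc ρ * (ℓ + 1) ^ n = 1 * (ℓ + 1) ^ n * ρ := by ring
        _ ≤ Mh * (ℓ + 1) ^ (n + 1) * ρ :=
          Nat.mul_le_mul (Nat.mul_le_mul (by omega) (Nat.pow_le_pow_right (Nat.succ_pos ℓ) (Nat.le_succ n))) le_rfl
    omega
  have hB : fm (ℓ + 1) ρ k 0 + fm (ℓ + 1) ρ k n ≤ 2 * (Mh * (ℓ + 1) ^ (k + 1) * ρ) := by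
    have h0 : fm (ℓ + 1) ρ k 0 = fm (ℓ + 1) ρ k 1 + ρ * (ℓ + 1) ^ 0 := fm_succ (lt_of_lt_of_le Nat.zero_lt_one hk)
    rw [pow_zero, mul_one] at h0
    have h1top : fm (ℓ + 1) ρ k 1 ≤ ρ * (ℓ + 1) ^ (k + 1) := fm_one_le_top hL2 hk
    have hn1 : fm (ℓ + 1) ρ k n ≤ fm (ℓ + 1) ρ k 1 := fm_le_fm_one hn hnk
    have hρle : ρ ≤ ρ * (ℓ + 1) ^ (k + 1) := by
      calc ρ = ρ * 1 := (mul_one ρ).symm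
        _ ≤ ρ * (ℓ + 1) ^ (k + 1) := Nat.mul_le_mul_left _ (Nat.one_le_pow _ _ (Nat.succ_pos ℓ))
    have h3 : 3 * (ρ * (ℓ + 1) ^ (k + 1)) ≤ 2 * (Mh * (ℓ + 1) ^ (k + 1) * ρ) := by
      calc 3 * (ρ * (ℓ + 1) ^ (k + 1)) ≤ 4 * (ρ * (ℓ + 1) ^ (k + 1)) := Nat.mul_le_mul_right _ (by norm_num)
        _ = 2 * (2 * (ℓ + 1) ^ (k + 1) * ρ) := by ring
        _ ≤ 2 * (Mh * (ℓ + 1) ^ (k + 1) * ρ) := Nat.mul_le_mul_left _ (Nat.mul_le_mul_right _ (Nat.mul_le_mul_right _ hMh))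
    omega
  have hD : (ℓ + 1) ^ k * M ≤ Mh * (ℓ + 1) ^ (k + 1) * M := by
    calc (ℓ + 1) ^ k * M = 1 * (ℓ + 1) ^ k * M := by ring
      _ ≤ Mh * (ℓ + 1) ^ (k + 1) * M :=
        Nat.mul_le_mul (Nat.mul_le_mul (by omega) (Nat.pow_le_pow_right (Nat.succ_pos ℓ) (Nat.le_succ k))) le_rfl
  have hN := N0_boxP_eq (ℓ := ℓ) (Mh := Mh) (M := M) (ρ := ρ) hnk i
  have hup : (ℓ + 1) ^ k * M + fm (ℓ + 1) ρ k 0 + Mh * (ℓ + 1) ^ (n + 1) * ρ + fm (ℓ + 1) ρ k n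
      ≤ N0 ℓ Mh n (boxP ℓ M ρ k n) i := by
    rw [hN]; omega
  constructor
  · -- `0 ≤ loC₀ + t ≤ x + t`
    have h3 : (0 : ℤ) ≤ loC (ℓ + 1) a ρ k 0 i + shift ℓ Mh a ρ k n i := by
      rw [e1]
      have : ((fm (ℓ + 1) ρ k 0 : ℕ) : ℤ) ≤ ((fm (ℓ + 1) ρ k n + Mh * (ℓ + 1) ^ (n + 1) * ρ : ℕ) : ℤ) := by exact_mod_cast hA
      rw [Nat.cast_add] at this
      linarith
    simp only [Pi.add_apply]
    linarith
  · -- `x + t ≤ hiC₀ + t < N₀`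
    have h3 : hiC (ℓ + 1) a M ρ k 0 i + 1 + shift ℓ Mh a ρ k n i ≤ (N0 ℓ Mh n (boxP ℓ M ρ k n) i : ℤ) := by
      rw [e2]; exact_mod_cast hup
    simp only [Pi.add_apply]
    linarith

/-- **ON `t + □₀`, LEVEL `0` MEANS THE COLLAR**: for `x ∈ □₀`, `levL0 (x + t) = 0 ⇔ x ∉ □₁`. [cite: Balaban1985RegularSpaces, (1.131) p.99; Balaban1984PropagatorsII, (2.3) p.224 («Λ₀ = Ω₁ᶜ»)] -/
theorem levL0_shift_eq_zero_iff {ℓ Mh : ℕ} (a : Fin (d + 1) → ℤ) (M : ℕ) {ρ k n : ℕ} (hρ : ℓ + 1 ≤ ρ) (hn : 1 ≤ n) (hnk : n ≤ k)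
    (x : Fin (d + 1) → ℤ) :
    levL0 ℓ Mh a M ρ k n (x + shift ℓ Mh a ρ k n) = 0 ↔ x ∉ cube (ℓ + 1) a M ρ k 1 := by
  have h := levL0_pos_iff a M hρ hn hnk (x + shift ℓ Mh a ρ k n) (Mh := Mh)
  rw [add_shift_sub_shift] at h
  constructor
  · intro h0 hx; have := h.mpr hx; omega
  · intro hx; by_contra h0; exact hx (h.mp (Nat.pos_of_ne_zero h0))

end Literature.MathematicalPhysics.QuantumFieldTheory.Balaban1983to89.B8CubeMemberBoxDomainsL0
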